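import Summits.QuantumFields.BalabanUV.Beta.FP.ConstrainedBiLaplacianFibreEntries

/-!
# `BalabanUV.Beta.FP.ConstrainedBiLaplacianFibreSides` — road «FP» for binder row D1, row **RHOA-4-GH (localisation half)** as re-worded
# by R-FP-29: FILE 3a of 3 — THE SIDE PERIODICITY OF THE REGROUPED ALIAS-FIBRE ENTRIES: `Gfib k k′ (p + 2π e_μ) = Gfib (σ_μ k) (σ_μ k′) p`
# at the strip points with `Re p_μ = −π`, through the un-regrouped Sherman–Morrison form and the identity `v·ṽ = |u|²` continued
# (`v n 0 z · vc n 0 z = uFactor n 0 z`)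

NOT IN PRINT; OUR PROOF ATTEMPT (binder row G-an2-4 ∕ (CONV-C), prover part P3, fibre∕strip lineage).  HONEST DEPENDENCY (cell records,
verbatim): «continuum YM on T⁴ ⇐ BetaPertH ∧ nine spine estimates (0/9 proved); BetaPertH ⇐ (D1) ∧ (D4) ∧ CAP+tail; G-an2-4 gates asym, D1
and NE2/3/4.»  HONEST FRAMING (cell contract, verbatim): «discharging `BetaPertH` makes Bałaban's UV stability UNCONDITIONAL — a real
constructive-QFT result; it is NOT the continuum limit and NOT the Clay problem.»  ABSOLUTE RULE (cell charter, verbatim): «No internally-minted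
statement may enter as a cited fact. Every hypothesis is either kernel-proved in this package or a verbatim quotation of a PUBLISHED theorem with
page reference. The manuscript(s) under audit are NOT citable for their own disputed steps — they are the thing under adjudication;
programme-internal (2001/route/tribunal) claims are never citable.»  THIS MODULE is [folklore] algebra over `B4StripSums` (`v`, `w`, `F`, `F_tr`,
`v_eq_quotient`, `w_ne_one`, `Sxi_eq_sq_mul_S1`), `B4StripCauchy.Sxi_ne_zero`, `B5Strip145Analytic` (`tr`, `sigma`, `sigmaEquiv`, `U_tr`,
`DeltaXi_shift_tr`, `re_DeltaXi_pos_of_edge`, `kappa_small`), FILE 1 (`den`, `kappaB`, `den_ne_zero_strip`) and FILES 2a∕2b (`vc`, `Fc`, `Fc_tr`,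
`ainv`, `Gfib`, `Gfib_eq_unregrouped`); it re-defines no symbol, cites nothing as a hypothesis, has no `def … : Prop` and no `sorry`.  It is the
`sides` input of `B4ContourShift.StripRegular` for the offset-pair multipliers of FILE 3b `FP/ConstrainedBiLaplacianKernel`.

## Contents (every `d`, every `n ≥ 1`, every order `s`)

* §1 `exp_neg_sub_one_mul` (`(e^{−a}−1)(e^{a}−1) = 2 − (e^{a}+e^{−a})`), `S1_eq_mul` (`S1 z = (e^{−iz}−1)(e^{iz}−1)`), `vc_zero_eq_quotient`,
  **`v_mul_vc_eq_uFactor : v n 0 z · vc n 0 z = uFactor n 0 z`** for `|Re z| < 2π` (`n ≥ 1`) — the continued `u·ū = |u|²` in one coordinate —,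
  **`F_zero_mul_Fc_zero_eq_U : F n 0 0 p · Fc n 0 0 p = U n 0 p`** on `|Re p_ν| < 2π` (the hypothesis `hU0` of `Gfib_eq_unregrouped`, discharged).
* §2 `Ssum n s q = Σ_j U_j·ainv_j` (the PERIODIC Sherman–Morrison denominator `⟨ũ, A⁻¹u⟩`), `den_div_eq_Ssum` (`den∕(Δ^ξ)^s = Ssum` where `Δ^ξ ≠ 0`),
  `Ssum_tr` (`Ssum (p + 2πe_μ) = Ssum p` for `p_μ ∉ {0, −2π}`), `sigma_eq_iff`.
* §3 **`Gfib_tr_side`**: for `p ∈ Strip d κ`, `0 ≤ κ ≤ kappaB d s`, and `Re p_μ = −π`: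
  `Gfib n s k k′ (tr p μ) = Gfib n s (sigma n μ k) (sigma n μ k′) p` — every hypothesis of the un-regrouped form holds on the strip sides
  (`Δ^ξ ≠ 0` by `re_DeltaXi_pos_of_edge`, `den ≠ 0` by FILE 1, shifted symbols by `DeltaXi_shift_ne_zero`, `hU0` by §1).

0∕4 row-D1 binders touched.  NOT RHOA-4-GH (FILE 3b open), NOT hbook, NOT D1, NOT BetaPertH, NOT continuum, NOT Clay.  Provenance:
prover-b2b-balaban-gan24-p3-g21-0 (unit `b2b-balaban-gan24-p3`, gen 21; R-FP-29 first refusal), 2026-08-21.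
-/

noncomputable section

namespace Summit.QuantumFields.BalabanUV.Beta.FP.ConstrainedBiLaplacianFibreSides

open Complex Finset ComplexConjugate
open Literature.MathematicalPhysics.QuantumFieldTheory.Balaban1983to89
open Literature.MathematicalPhysics.QuantumFieldTheory.Balaban1983to89.B4Strip
open Literature.MathematicalPhysics.QuantumFieldTheory.Balaban1983to89.B4StripCauchy
open Literature.MathematicalPhysics.QuantumFieldTheory.Balaban1983to89.B5Strip145Analytic
open Literature.MathematicalPhysics.QuantumFieldTheory.Balaban1983to89.B4StripSums
open Summit.QuantumFields.BalabanUV.Beta.FP.ConstrainedBiLaplacianStrip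
open Summit.QuantumFields.BalabanUV.Beta.FP.ConstrainedBiLaplacianFibre
open Summit.QuantumFields.BalabanUV.Beta.FP.ConstrainedBiLaplacianFibreEntries
open scoped Real

variable {d : ℕ}

/-! ## §1 The continued identity `u·ū = |u|²` -/

/-- [folklore] `(e^{−a} − 1)(e^{a} − 1) = 2 − (e^{a} + e^{−a})`. -/
theorem exp_neg_sub_one_mul (a : ℂ) : (cexp (-a) - 1) * (cexp a - 1) = 2 - (cexp a + cexp (-a)) := by
  have h : cexp (-a) * cexp a = 1 := by rw [← Complex.exp_add, neg_add_cancel, Complex.exp_zero]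
  calc (cexp (-a) - 1) * (cexp a - 1) = cexp (-a) * cexp a - cexp a - cexp (-a) + 1 := by ring
    _ = 2 - (cexp a + cexp (-a)) := by rw [h]; ring

/-- [folklore] `S1 z = 2 − 2cos z = (e^{−iz} − 1)(e^{iz} − 1)`. -/
theorem S1_eq_mul (z : ℂ) : S1 z = (cexp (-(I * z)) - 1) * (cexp (I * z) - 1) := by
  rw [exp_neg_sub_one_mul]
  unfold S1
  rw [Complex.two_cos]
  have e1 : z * I = I * z := mul_comm _ _
  have e2 : -z * I = -(I * z) := by ring
  rw [e1, e2]

/-- [folklore] The conjugate factor at residue `0` in closed form off the zeros of the denominator: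
`vc n 0 z = (e^{iz} − 1)∕(n (e^{iz∕n} − 1))` whenever `S_ξ(z) ≠ 0` (conjugate of `B4StripSums.v_eq_quotient`). -/
theorem vc_zero_eq_quotient (n : ℕ) (hn : n ≠ 0) {z : ℂ} (hS : Sxi n z ≠ 0) :
    vc n 0 z = (cexp (I * z) - 1) / ((n : ℂ) * (cexp (I * z / n) - 1)) := by
  have hS' : Sxi n (conj z + 2 * π * ((0 : ℕ) : ℂ)) ≠ 0 := by
    rw [Nat.cast_zero, mul_zero, add_zero]
    intro h
    apply hS
    have := congrArg conj h
    rw [map_zero] at this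
    rw [← this]
    unfold Sxi
    rw [map_mul, map_sub, map_mul, ← Complex.cos_conj, map_div₀, Complex.conj_conj, map_natCast, map_pow, map_natCast,
      map_ofNat]
  have hw : w n 0 (conj z) ≠ 1 := w_ne_one n 0 hS'
  rw [vc_eq_conj, v_eq_quotient n 0 hn hw, map_div₀, map_sub, map_one, map_mul, map_natCast, map_sub, map_one, conj_w_conj,
    ← Complex.exp_conj, map_neg, map_mul, Complex.conj_I, Complex.conj_conj, Nat.cast_zero, mul_zero, add_zero]
  congr 2
  ring

/-- [folklore] **THE CONTINUED `u·ū = |u|²` IN ONE COORDINATE**: `v n 0 z · vc n 0 z = uFactor n 0 z` for `|Re z| < 2π`, `n ≥ 1`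
(at `z = 0` all three are `1`; elsewhere `S_ξ(z) ≠ 0` and the two geometric sums multiply to `S1 z ∕ S_ξ(z)`). -/
theorem v_mul_vc_eq_uFactor (n : ℕ) (hn : 1 ≤ n) {z : ℂ} (hx : |z.re| < 2 * π) : v n 0 z * vc n 0 z = uFactor n 0 z := by
  have hn0 : n ≠ 0 := by omega
  have hnC : (n : ℂ) ≠ 0 := Nat.cast_ne_zero.mpr hn0
  by_cases hz : z = 0
  · subst hz
    have hv : v n 0 0 = 1 := by
      unfold v w
      simp only [Nat.cast_zero, mul_zero, add_zero, zero_div, neg_zero, Complex.exp_zero, one_pow, Finset.sum_const,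
        Finset.card_range, nsmul_eq_mul, mul_one]
      exact inv_mul_cancel₀ hnC
    have hvc : vc n 0 0 = 1 := by
      unfold vc ef
      simp only [Nat.cast_zero, mul_zero, add_zero, zero_mul, zero_div, Complex.exp_zero, Finset.sum_const,
        Finset.card_range, nsmul_eq_mul, mul_one]
      exact inv_mul_cancel₀ hnC
    rw [hv, hvc, one_mul]
    unfold uFactor
    simp
  · have hS : Sxi n z ≠ 0 := Sxi_ne_zero n hn hx hz
    have hS' : Sxi n (z + 2 * π * ((0 : ℕ) : ℂ)) ≠ 0 := by rwa [Nat.cast_zero, mul_zero, add_zero]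
    have hw : w n 0 z ≠ 1 := w_ne_one n 0 hS'
    have hv := v_eq_quotient n 0 hn0 hw
    have hwdef : w n 0 z = cexp (-(I * z / n)) := by unfold w; rw [Nat.cast_zero, mul_zero, add_zero]
    rw [hv, vc_zero_eq_quotient n hn0 hS, hwdef]
    have huf : uFactor n 0 z = S1 z / Sxi n z := by unfold uFactor; rw [if_pos rfl, if_neg hz]
    rw [huf, Sxi_eq_sq_mul_S1, S1_eq_mul z, S1_eq_mul (z / n)]
    have e1 : I * (z / n) = I * z / n := by ring
    rw [e1]
    have hd1 : cexp (-(I * z / n)) - 1 ≠ 0 := by rw [← hwdef]; exact sub_ne_zero.mpr hw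
    have hd2 : cexp (I * z / n) - 1 ≠ 0 := by
      intro h
      apply hd1
      have h1 : cexp (I * z / n) = 1 := sub_eq_zero.mp h
      rw [Complex.exp_neg, h1, inv_one, sub_self]
    field_simp

/-- [folklore] **THE HYPOTHESIS `hU0` OF `Gfib_eq_unregrouped`, DISCHARGED**: `F n 0 0 p · Fc n 0 0 p = U n 0 p` whenever `|Re p_ν| < 2π` for all `ν`
(`n ≥ 1`). -/
theorem F_zero_mul_Fc_zero_eq_U (n : ℕ) [NeZero n] {p : Fin d → ℂ} (hp : ∀ ν, |(p ν).re| < 2 * π) :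
    F n (fun _ => 0) (fun _ => (0 : Fin n)) p * Fc n (fun _ => 0) (fun _ => (0 : Fin n)) p = U n (fun _ => (0 : Fin n)) p := by
  have hn : 1 ≤ n := Nat.one_le_iff_ne_zero.mpr (NeZero.ne n)
  unfold F Fc U
  rw [← Finset.prod_mul_distrib]
  refine Finset.prod_congr rfl fun ν _ => ?_
  have h1 : ef n ((fun _ => (0 : Fin n)) ν : ℕ) ((fun _ => (0 : Fin n)) ν : ℕ) (p ν) = 1 := by unfold ef; simp
  have h2 : efc n ((fun _ => (0 : Fin n)) ν : ℕ) ((fun _ => (0 : Fin n)) ν : ℕ) (p ν) = 1 := by unfold efc; simp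
  rw [h1, h2, one_mul, one_mul]
  exact v_mul_vc_eq_uFactor n hn (hp ν)

/-! ## §2 The periodic Sherman–Morrison denominator -/

/-- [folklore] `Ssum n s q = Σ_j U_j(q)·((Δ^ξ(q+2πj))^s)⁻¹` — the un-regrouped Sherman–Morrison denominator `⟨ũ, A⁻¹u⟩` (periodic; singular at
`q = 0`). -/
def Ssum (n : ℕ) [NeZero n] (s : ℕ) (q : Fin d → ℂ) : ℂ := ∑ j : Fin d → Fin n, U n j q * ainv n s j q

/-- [folklore] `den∕(Δ^ξ)^s = Ssum` wherever `Δ^ξ(q) ≠ 0`. -/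
theorem den_div_eq_Ssum (n : ℕ) [NeZero n] (s : ℕ) {q : Fin d → ℂ} (h0 : DeltaXi n 0 q ≠ 0) :
    den n s q / DeltaXi n 0 q ^ s = Ssum n s q := by
  have hA0 : DeltaXi n 0 q ^ s ≠ 0 := pow_ne_zero s h0
  unfold den Ssum
  rw [Finset.sum_div]
  refine Finset.sum_congr rfl fun j _ => ?_
  unfold ainv
  rw [R_eq_div n 0 j q h0, div_pow]
  field_simp

/-- [folklore] `σ_μ` is injective: `sigma n μ k = sigma n μ k′ ↔ k = k′`. -/
theorem sigma_eq_iff (n : ℕ) [NeZero n] (μ : Fin d) (k k' : Fin d → Fin n) : sigma n μ k = sigma n μ k' ↔ k = k' :=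
  (sigmaEquiv n μ).injective.eq_iff

/-- [folklore] **PERIODICITY OF THE UN-REGROUPED DENOMINATOR**: `Ssum (p + 2π e_μ) = Ssum p` for `p_μ ∉ {0, −2π}` (relabel `j ↦ σ_μ j`;
`B5Strip145Analytic.U_tr`, `DeltaXi_shift_tr`). -/
theorem Ssum_tr (n : ℕ) [NeZero n] (s : ℕ) (p : Fin d → ℂ) (μ : Fin d) (hz : p μ ≠ 0) (hz' : p μ + 2 * Real.pi ≠ 0) :
    Ssum n s (tr p μ) = Ssum n s p := by
  unfold Ssum
  calc ∑ j : Fin d → Fin n, U n j (tr p μ) * ainv n s j (tr p μ)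
      = ∑ j : Fin d → Fin n, U n (sigma n μ j) p * ainv n s (sigma n μ j) p := by
        refine Finset.sum_congr rfl fun j _ => ?_
        unfold ainv
        rw [U_tr n j p μ hz hz', DeltaXi_shift_tr]
    _ = ∑ j : Fin d → Fin n, U n j p * ainv n s j p :=
        Equiv.sum_comp (sigmaEquiv n μ) (fun j => U n j p * ainv n s j p)

/-! ## §3 The side periodicity of the regrouped entries -/

/-- [folklore] At a point `q` of the strip `Strip d κ` (`0 ≤ κ ≤ kappaB d s`) with `|Re q_μ| = π` for some `μ`, every hypothesis of
`Gfib_eq_unregrouped` holds: `Δ^ξ(q) ≠ 0`, `den ≠ 0`, all shifted symbols `≠ 0`, and `u_0ũ_0 = U_0`. -/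
theorem unregrouped_hyps (n : ℕ) [NeZero n] (s : ℕ) {κ : ℝ} (hκ0 : 0 ≤ κ) (hκ : κ ≤ kappaB d s) {q : Fin d → ℂ}
    (hq : q ∈ Strip d κ) (μ : Fin d) (hμ : |(q μ).re| = Real.pi) :
    DeltaXi n 0 q ≠ 0 ∧ den n s q ≠ 0 ∧ (∀ j : Fin d → Fin n, DeltaXi n 0 (shift n j q) ≠ 0) ∧
      F n (fun _ => 0) (fun _ => (0 : Fin n)) q * Fc n (fun _ => 0) (fun _ => (0 : Fin n)) q = U n (fun _ => (0 : Fin n)) q := by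
  have hκr : κ ≤ rOf d := hκ.trans (kappaB_le_rOf d s)
  obtain ⟨hκ1, hdκ⟩ := kappa_small hκ0 hκr
  have hfat : q ∈ Fat d (rOf d) := strip_subset_fat (rOf_pos d).le hκr hq
  have h0 : DeltaXi n 0 q ≠ 0 := by
    intro h
    have := re_DeltaXi_pos_of_edge n 0 le_rfl hκ1 hdκ (fun ν => (hq ν).2) μ hμ
    rw [h, Complex.zero_re] at this
    exact lt_irrefl _ this
  refine ⟨h0, den_ne_zero_strip n s (strip_mono hκ hq), fun j => ?_, ?_⟩
  · by_cases hj : j = fun _ => (0 : Fin n)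
    · rw [hj, shift_zero]; exact h0
    · exact DeltaXi_shift_ne_zero n 0 le_rfl (rOf_le d) (d_mul_rOf_sq_le d) hfat j hj
  · refine F_zero_mul_Fc_zero_eq_U n fun ν => ?_
    have := (hq ν).1
    linarith [Real.pi_pos]

/-- [folklore] **SIDE PERIODICITY OF THE REGROUPED FIBRE ENTRIES**: at a strip point `p ∈ Strip d κ` (`0 ≤ κ ≤ kappaB d s`) with `Re p_μ = −π`,
`Gfib n s k k′ (p + 2π e_μ) = Gfib n s (σ_μ k) (σ_μ k′) p` for all `k, k′` — both sides equal the un-regrouped Sherman–Morrison entries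
(`Gfib_eq_unregrouped`, hypotheses by `unregrouped_hyps` at `p` and at `tr p μ`), which relabel by `F_tr`, `Fc_tr`, `DeltaXi_shift_tr` and
the periodicity `Ssum_tr` of `⟨ũ, A⁻¹u⟩ = den∕(Δ^ξ)^s`. -/
theorem Gfib_tr_side (n : ℕ) [NeZero n] (s : ℕ) {κ : ℝ} (hκ0 : 0 ≤ κ) (hκ : κ ≤ kappaB d s) {p : Fin d → ℂ}
    (hp : p ∈ Strip d κ) (μ : Fin d) (hre : (p μ).re = -Real.pi) (k k' : Fin d → Fin n) :
    Gfib n s k k' (tr p μ) = Gfib n s (sigma n μ k) (sigma n μ k') p := by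
  have hπ := Real.pi_pos
  have hz : p μ ≠ 0 := by
    intro h; rw [h, Complex.zero_re] at hre; linarith
  have hz' : p μ + 2 * Real.pi ≠ 0 := by
    intro h
    have := congrArg Complex.re h
    rw [← tr_apply_self, tr_re_self, hre, Complex.zero_re] at this
    linarith
  have hp1 : tr p μ ∈ Strip d κ := tr_mem_Strip hp μ hre
  obtain ⟨h0, hden, hsh, hU0⟩ := unregrouped_hyps n s hκ0 hκ hp μ (by rw [hre, abs_neg, abs_of_pos hπ])
  obtain ⟨h0', hden', hsh', hU0'⟩ := unregrouped_hyps n s hκ0 hκ hp1 μ (by rw [tr_re_self, hre]; ring_nf; exact abs_of_pos hπ)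
  rw [Gfib_eq_unregrouped n s k k' (tr p μ) h0' hden' hsh' hU0',
    Gfib_eq_unregrouped n s (sigma n μ k) (sigma n μ k') p h0 hden hsh hU0,
    den_div_eq_Ssum n s h0', den_div_eq_Ssum n s h0, Ssum_tr n s p μ hz hz', F_tr, Fc_tr, DeltaXi_shift_tr, DeltaXi_shift_tr]
  simp only [sigma_eq_iff]

end Summit.QuantumFields.BalabanUV.Beta.FP.ConstrainedBiLaplacianFibreSides

end
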